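import Summits.RiemannHypothesis.RiemannHypothesis.Theorems.WeilGroundStateGroundStatesConvergeToXiStubDirichletEnergyMul
import Summits.RiemannHypothesis.RiemannHypothesis.Theorems.WeilGroundStateGroundStatesConvergeToXiWeightedL1
import Literature.Analysis.Calculus.SmoothCutoff
import HarnessLib

/-!
# Stub `stub_weightedLineBudget` of the line `Sketch` (crux `WeilGroundState.GroundStatesConvergeToXi`,
item stmt-RiemannHypothesis-1527, rev L9)

**Log-weighted vertical-line budgets are form-bounded (W10b, RH-free).**  Assume (W9) that for
every window `a > 0` the log-weighted Plancherel integral on the critical line is form-bounded,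
`∫ ‖ĝ(1/2+it)‖² log(|t|+2) dt ≤ A·Re Q(g) + B·‖g‖₂²` for test functions `g` supported in
`[-a, a]`.  Then the same holds, with new constants `A, B ≥ 0` depending only on `a`, for the
budgets `∫ ‖(g·yⁿ)^(x+it)‖² log(|t|+2) dt` on every line `Re s = x ∈ [0, 1]` and `n ≤ 2`.

Proof outline.
1. Shift: `ĥ(x+it) = (h·e^{(x-1/2)y})^(1/2+it)` (`lineBudget_weilMellin_shift`), so the budget of
   `g·yⁿ` on `Re s = x` is the critical-line budget of `h = g·yⁿe^{(x-1/2)y} = w·g`, where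
   `w = cutoff(a+1)·yⁿe^{(x-1/2)y}` is a smooth compactly supported multiplier equal to
   `yⁿe^{(x-1/2)y}` on the window, with `‖w‖ ≤ W`, `‖w'‖ ≤ L`, `W, L` depending only on `a`
   (`lineBudget_exists_multiplier`).  W9 applies to `h`.
2. `‖h‖₂² ≤ W² ‖g‖₂²`, and `Re Q(h) ≤ 2W² Re Q(g) + B'‖g‖₂²` by the Markov decomposition
   `Re Q = P + 𝓔_a − M_a‖·‖₂²` (`weilQuadratic_re_eq_weilPoleForm_add_weilDirichletEnergy_sub`),
   the multiplier bound `𝓔_a(w g) ≤ 2W²𝓔_a(g) + K(W²+L²)‖g‖₂²` (`stub_dirichletEnergy_mul`) and the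
   window bound on pole forms `|P(f)| ≤ C_a ‖f‖₂²` (`lineBudget_exists_abs_weilPoleForm_le`:
   `|∫ f cosh(t/2)|, |∫ f sinh(t/2)| ≤ cosh(a/2) ∫|f| ≤ cosh(a/2) √(2a) ‖f‖₂`, Cauchy–Schwarz on
   the window, `weightedL1_integral_norm_le_sqrt`).
3. Collect: `A = 2A₉W²`, `B = A₉B' + B₉W²`.
-/

set_option linter.dupNamespace false

noncomputable section

open MeasureTheory Complex Filter Set
open scoped Real Topology ComplexConjugate ArithmeticFunction.vonMangoldt ContDiff

namespace Summit.RiemannHypothesis.RiemannHypothesis.Theorems.GroundStatesConvergeToXi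

open Literature.NumberTheory.LFunctions Literature.Analysis.Calculus

/-! ## The shift to the critical line -/

/-- **Shift to the critical line**: `ĥ(x + it) = (h·e^{(x-1/2)y})^(1/2 + it)` (combine the
exponentials in `ĥ(s) = ∫ h(y) e^{(s-1/2)y} dy`). [folklore] -/
theorem lineBudget_weilMellin_shift (h : ℝ → ℂ) (x t : ℝ) :
    weilMellin h (x + t * I) =
      weilMellin (fun y : ℝ => h y * cexp (((x : ℂ) - 1 / 2) * y)) (1 / 2 + t * I) := by
  unfold weilMellin
  congr 1
  funext y
  have e : ((x : ℂ) + t * I - 1 / 2) * (y : ℂ) =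
      ((x : ℂ) - 1 / 2) * y + (1 / 2 + t * I - 1 / 2) * y := by ring
  rw [e, Complex.exp_add]
  ring

/-! ## Pole forms on a window -/

/-- A moment `∫ f φ` of a window test function against a real weight with `|φ| ≤ cosh(a/2)` on the
window is at most `cosh(a/2) ∫ ‖f‖`. [folklore] -/
theorem lineBudget_norm_integral_mul_le {a : ℝ} {f : ℝ → ℂ} (hf : IsWeilTest f)
    (hsupp : tsupport f ⊆ Icc (-a) a) {φ : ℝ → ℝ}
    (hφ : ∀ t ∈ Icc (-a) a, |φ t| ≤ Real.cosh (a / 2)) :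
    ‖∫ t : ℝ, f t * (φ t : ℂ)‖ ≤ Real.cosh (a / 2) * ∫ t : ℝ, ‖f t‖ := by
  have hfi : Integrable f := hf.1.continuous.integrable_of_hasCompactSupport hf.2
  rw [← integral_const_mul]
  refine norm_integral_le_of_norm_le (hfi.norm.const_mul _) (ae_of_all _ fun t => ?_)
  by_cases ht : t ∈ Icc (-a) a
  · rw [norm_mul, Complex.norm_real, Real.norm_eq_abs, mul_comm (Real.cosh _)]
    exact mul_le_mul_of_nonneg_left (hφ t ht) (norm_nonneg _)
  · have h0 : f t = 0 := image_eq_zero_of_notMem_tsupport fun h => ht (hsupp h)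
    simp [h0]

/-- **Pole forms are `L²`-bounded on a window**: there is `C = C(a) ≥ 0` with
`|P(f)| ≤ C ‖f‖₂²` for test functions `f` supported in `[-a, a]`
(`|∫ f cosh(t/2)|, |∫ f sinh(t/2)| ≤ cosh(a/2) ∫|f|` and Cauchy–Schwarz on the window). [folklore] -/
theorem lineBudget_exists_abs_weilPoleForm_le (a : ℝ) :
    ∃ C : ℝ, 0 ≤ C ∧ ∀ f : ℝ → ℂ, IsWeilTest f → tsupport f ⊆ Icc (-a) a →
      |weilPoleForm f| ≤ C * ∫ t : ℝ, ‖f t‖ ^ 2 := by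
  obtain ⟨Ka, hKa⟩ : ∃ Ka : ℝ,
      Ka = (∫ t, ‖(Icc (-a) a).indicator (fun _ => (1 : ℂ)) t‖ ^ (2 : ℝ)) ^ (1 / (2 : ℝ)) :=
    ⟨_, rfl⟩
  refine ⟨2 * Real.cosh (a / 2) ^ 2 * Ka ^ 2, by positivity, fun f hf hsupp => ?_⟩
  have hf0 : ∀ t, t ∉ Icc (-a) a → f t = 0 := fun t ht =>
    image_eq_zero_of_notMem_tsupport fun h => ht (hsupp h)
  have hN0 : 0 ≤ ∫ t, ‖f t‖ := integral_nonneg fun _ => norm_nonneg _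
  have hN20 : 0 ≤ ∫ t, ‖f t‖ ^ 2 := integral_nonneg fun _ => by positivity
  have hCS : ∫ t, ‖f t‖ ≤ Real.sqrt (∫ t, ‖f t‖ ^ 2) * Ka := by
    rw [hKa]
    exact weightedL1_integral_norm_le_sqrt hf.memLp_two (ae_of_all _ hf0)
  have hNsq : (∫ t, ‖f t‖) ^ 2 ≤ Ka ^ 2 * ∫ t, ‖f t‖ ^ 2 := by
    calc (∫ t, ‖f t‖) ^ 2 ≤ (Real.sqrt (∫ t, ‖f t‖ ^ 2) * Ka) ^ 2 := pow_le_pow_left₀ hN0 hCS 2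
      _ = Ka ^ 2 * ∫ t, ‖f t‖ ^ 2 := by rw [mul_pow, Real.sq_sqrt hN20]; ring
  have hta : ∀ t ∈ Icc (-a) a, |t / 2| ≤ |a / 2| := fun t ht => by
    rw [abs_div, abs_div, abs_two]
    exact div_le_div_of_nonneg_right ((abs_le.2 ⟨ht.1, ht.2⟩).trans (le_abs_self a)) zero_le_two
  have hcosh : ‖∫ t : ℝ, f t * (Real.cosh (t / 2) : ℂ)‖ ≤ Real.cosh (a / 2) * ∫ t, ‖f t‖ :=
    lineBudget_norm_integral_mul_le hf hsupp fun t ht => by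
      rw [abs_of_pos (Real.cosh_pos _)]
      exact Real.cosh_le_cosh.2 (hta t ht)
  have hsc : ∀ u : ℝ, |Real.sinh u| ≤ Real.cosh u := fun u => by
    rw [abs_le]
    refine ⟨?_, (Real.sinh_lt_cosh u).le⟩
    have h := Real.sinh_lt_cosh (-u)
    rw [Real.sinh_neg, Real.cosh_neg] at h
    linarith
  have hsinh : ‖∫ t : ℝ, f t * (Real.sinh (t / 2) : ℂ)‖ ≤ Real.cosh (a / 2) * ∫ t, ‖f t‖ :=
    lineBudget_norm_integral_mul_le hf hsupp fun t ht =>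
      (hsc _).trans (Real.cosh_le_cosh.2 (hta t ht))
  have hX : ‖∫ t : ℝ, f t * (Real.cosh (t / 2) : ℂ)‖ ^ 2 ≤
      Real.cosh (a / 2) ^ 2 * (Ka ^ 2 * ∫ t, ‖f t‖ ^ 2) :=
    (pow_le_pow_left₀ (norm_nonneg _) hcosh 2).trans
      (by rw [mul_pow]; exact mul_le_mul_of_nonneg_left hNsq (sq_nonneg _))
  have hY : ‖∫ t : ℝ, f t * (Real.sinh (t / 2) : ℂ)‖ ^ 2 ≤
      Real.cosh (a / 2) ^ 2 * (Ka ^ 2 * ∫ t, ‖f t‖ ^ 2) :=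
    (pow_le_pow_left₀ (norm_nonneg _) hsinh 2).trans
      (by rw [mul_pow]; exact mul_le_mul_of_nonneg_left hNsq (sq_nonneg _))
  have hX0 := sq_nonneg ‖∫ t : ℝ, f t * (Real.cosh (t / 2) : ℂ)‖
  have hY0 := sq_nonneg ‖∫ t : ℝ, f t * (Real.sinh (t / 2) : ℂ)‖
  rw [weilPoleForm, abs_le]
  constructor <;> linarith

/-! ## The multiplier `cutoff (a+1) · yⁿ e^{(x-1/2)y}` -/

/-- Size of the kernel: `‖yⁿ e^{cy}‖ = |y|ⁿ e^{(Re c) y}`. [folklore] -/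
theorem lineBudget_norm_kernel (c : ℂ) (n : ℕ) (y : ℝ) :
    ‖(y : ℂ) ^ n * cexp (c * y)‖ = |y| ^ n * Real.exp (c.re * y) := by
  rw [norm_mul, norm_pow, Complex.norm_real, Real.norm_eq_abs, Complex.norm_exp]
  simp [Complex.mul_re]

/-- Derivative of the kernel: `(yⁿ e^{cy})' = (n yⁿ⁻¹ + c yⁿ) e^{cy}`. [folklore] -/
theorem lineBudget_hasDerivAt_kernel (c : ℂ) (n : ℕ) (y : ℝ) :
    HasDerivAt (fun y : ℝ => (y : ℂ) ^ n * cexp (c * y))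
      (((n : ℂ) * (y : ℂ) ^ (n - 1) + c * (y : ℂ) ^ n) * cexp (c * y)) y := by
  have h1 : HasDerivAt (fun z : ℂ => z ^ n * cexp (c * z))
      ((n : ℂ) * (y : ℂ) ^ (n - 1) * cexp (c * y) + (y : ℂ) ^ n * (cexp (c * y) * (c * 1)))
      (y : ℂ) :=
    (hasDerivAt_pow n (y : ℂ)).mul ((hasDerivAt_id' (y : ℂ)).const_mul c).cexp
  exact h1.comp_ofReal.congr_deriv (by ring)

/-- **The smooth multipliers.**  For `a > 0` there are `W, L ≥ 0` such that for every `n ≤ 2` and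
`x ∈ [0, 1]` there is a test function `w` (namely `cutoff (a+1) · yⁿ e^{(x-1/2)y}`) with
`‖w‖ ≤ W`, `‖w'‖ ≤ L` and `w(y) = yⁿ e^{(x-1/2)y}` on `[-a, a]`. [folklore] -/
theorem lineBudget_exists_multiplier {a : ℝ} (ha : 0 < a) :
    ∃ W L : ℝ, 0 ≤ W ∧ 0 ≤ L ∧ ∀ n : ℕ, n ≤ 2 → ∀ x : ℝ, x ∈ Icc (0 : ℝ) 1 →
      ∃ w : ℝ → ℂ, IsWeilTest w ∧ (∀ y, ‖w y‖ ≤ W) ∧ (∀ y, ‖deriv w y‖ ≤ L) ∧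
        ∀ y ∈ Icc (-a) a, w y = (y : ℂ) ^ n * cexp (((x : ℂ) - 1 / 2) * y) := by
  obtain ⟨D, hD0, hD⟩ := exists_bound_deriv_cutoff
  obtain ⟨R, hR⟩ : ∃ R : ℝ, R = a + 1 := ⟨_, rfl⟩
  have hR1 : 1 ≤ R := by rw [hR]; linarith
  have hR0 : 0 ≤ R := zero_le_one.trans hR1
  refine ⟨R ^ 2 * Real.exp (R / 2), (D * R ^ 2 + (2 * R + R ^ 2)) * Real.exp (R / 2),
    by positivity, by positivity, fun n hn x hx => ?_⟩
  obtain ⟨c, hc⟩ : ∃ c : ℂ, c = (x : ℂ) - 1 / 2 := ⟨_, rfl⟩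
  have hcn : ‖c‖ ≤ 1 / 2 := by
    have e : c = ((x - 1 / 2 : ℝ) : ℂ) := by rw [hc]; push_cast; ring
    rw [e, Complex.norm_real, Real.norm_eq_abs, abs_le]
    constructor <;> linarith [hx.1, hx.2]
  -- size of the kernel and of its derivative on `|y| ≤ R`
  have hexp : ∀ y : ℝ, |y| ≤ R → Real.exp (c.re * y) ≤ Real.exp (R / 2) := fun y hy => by
    refine Real.exp_le_exp.2 ?_
    calc c.re * y ≤ |c.re * y| := le_abs_self _
      _ = |c.re| * |y| := abs_mul _ _
      _ ≤ 1 / 2 * R :=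
          mul_le_mul ((Complex.abs_re_le_norm c).trans hcn) hy (abs_nonneg _) (by norm_num)
      _ = R / 2 := by ring
  have hyn : ∀ y : ℝ, |y| ≤ R → |y| ^ n ≤ R ^ 2 := fun y hy =>
    (pow_le_pow_left₀ (abs_nonneg _) hy n).trans (pow_le_pow_right₀ hR1 hn)
  have hyn' : ∀ y : ℝ, |y| ≤ R → (n : ℝ) * |y| ^ (n - 1) ≤ 2 * R := fun y hy => by
    have h1 : |y| ^ (n - 1) ≤ R := by
      calc |y| ^ (n - 1) ≤ R ^ (n - 1) := pow_le_pow_left₀ (abs_nonneg _) hy (n - 1)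
        _ ≤ R ^ 1 := pow_le_pow_right₀ hR1 (by omega)
        _ = R := pow_one R
    have h2 : (n : ℝ) ≤ 2 := by exact_mod_cast hn
    exact mul_le_mul h2 h1 (by positivity) zero_le_two
  have hpb : ∀ y : ℝ, |y| ≤ R → ‖(y : ℂ) ^ n * cexp (c * y)‖ ≤ R ^ 2 * Real.exp (R / 2) :=
    fun y hy => by
      rw [lineBudget_norm_kernel]
      exact mul_le_mul (hyn y hy) (hexp y hy) (Real.exp_pos _).le (by positivity)
  have hp'b : ∀ y : ℝ, |y| ≤ R →
      ‖((n : ℂ) * (y : ℂ) ^ (n - 1) + c * (y : ℂ) ^ n) * cexp (c * y)‖ ≤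
        (2 * R + R ^ 2) * Real.exp (R / 2) := fun y hy => by
    have hre : (c * (y : ℂ)).re = c.re * y := by simp [Complex.mul_re]
    rw [norm_mul, Complex.norm_exp, hre]
    refine mul_le_mul ?_ (hexp y hy) (Real.exp_pos _).le (by positivity)
    calc ‖(n : ℂ) * (y : ℂ) ^ (n - 1) + c * (y : ℂ) ^ n‖
        ≤ ‖(n : ℂ) * (y : ℂ) ^ (n - 1)‖ + ‖c * (y : ℂ) ^ n‖ := norm_add_le _ _
      _ = (n : ℝ) * |y| ^ (n - 1) + ‖c‖ * |y| ^ n := by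
          rw [norm_mul, norm_mul, Complex.norm_natCast, norm_pow, norm_pow, Complex.norm_real,
            Real.norm_eq_abs]
      _ ≤ 2 * R + 1 / 2 * R ^ 2 :=
          add_le_add (hyn' y hy) (mul_le_mul hcn (hyn y hy) (by positivity) (by norm_num))
      _ ≤ 2 * R + R ^ 2 := by nlinarith [sq_nonneg R]
  -- the multiplier `w = cutoff R · kernel`
  have hχd : Differentiable ℝ (cutoff R) := (contDiff_cutoff R (n := 1)).differentiable (by simp)
  have hpd := lineBudget_hasDerivAt_kernel c n
  refine ⟨fun y => (cutoff R y : ℂ) * ((y : ℂ) ^ n * cexp (c * y)), ⟨?_, ?_⟩, ?_, ?_, ?_⟩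
  · -- smooth
    have h1 : ContDiff ℝ ∞ (fun y : ℝ => (cutoff R y : ℂ)) :=
      Complex.ofRealCLM.contDiff.comp (contDiff_cutoff R)
    have h2 : ContDiff ℝ ∞ (fun y : ℝ => (y : ℂ) ^ n * cexp (c * y)) :=
      (Complex.ofRealCLM.contDiff.pow n).mul
        (Complex.contDiff_exp.comp (contDiff_const.mul Complex.ofRealCLM.contDiff))
    exact h1.mul h2
  · -- compactly supported in `[-R, R]`
    refine HasCompactSupport.intro (isCompact_Icc : IsCompact (Icc (-R) R)) fun y hy => ?_
    have hy' : R ≤ |y| := by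
      rw [mem_Icc, not_and_or, not_le, not_le] at hy
      rcases hy with h | h
      · exact le_abs.2 (Or.inr (by linarith))
      · exact le_abs.2 (Or.inl h.le)
    simp [cutoff_eq_zero hy']
  · -- `‖w‖ ≤ W`
    intro y
    rcases le_or_gt R |y| with hy | hy
    · simp only [cutoff_eq_zero hy, Complex.ofReal_zero, zero_mul, norm_zero]
      positivity
    · rw [norm_mul, Complex.norm_real, Real.norm_eq_abs]
      calc |cutoff R y| * ‖(y : ℂ) ^ n * cexp (c * y)‖ ≤ 1 * (R ^ 2 * Real.exp (R / 2)) :=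
            mul_le_mul (abs_cutoff_le_one R y) (hpb y hy.le) (norm_nonneg _) zero_le_one
        _ = R ^ 2 * Real.exp (R / 2) := one_mul _
  · -- `‖w'‖ ≤ L`
    intro y
    have hwd : HasDerivAt (fun y : ℝ => (cutoff R y : ℂ) * ((y : ℂ) ^ n * cexp (c * y)))
        (((deriv (cutoff R) y : ℝ) : ℂ) * ((y : ℂ) ^ n * cexp (c * y)) +
          (cutoff R y : ℂ) * (((n : ℂ) * (y : ℂ) ^ (n - 1) + c * (y : ℂ) ^ n) * cexp (c * y)))
        y :=
      (hχd y).hasDerivAt.ofReal_comp.mul (hpd y)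
    rw [hwd.deriv]
    rcases le_or_gt R |y| with hy | hy
    · rw [cutoff_eq_zero hy, deriv_cutoff_eq_zero_of_le hy]
      simp only [Complex.ofReal_zero, zero_mul, add_zero, norm_zero]
      positivity
    · calc ‖((deriv (cutoff R) y : ℝ) : ℂ) * ((y : ℂ) ^ n * cexp (c * y)) +
            (cutoff R y : ℂ) * (((n : ℂ) * (y : ℂ) ^ (n - 1) + c * (y : ℂ) ^ n) * cexp (c * y))‖
          ≤ ‖((deriv (cutoff R) y : ℝ) : ℂ) * ((y : ℂ) ^ n * cexp (c * y))‖ +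
            ‖(cutoff R y : ℂ) *
              (((n : ℂ) * (y : ℂ) ^ (n - 1) + c * (y : ℂ) ^ n) * cexp (c * y))‖ :=
            norm_add_le _ _
        _ = |deriv (cutoff R) y| * ‖(y : ℂ) ^ n * cexp (c * y)‖ +
            |cutoff R y| * ‖((n : ℂ) * (y : ℂ) ^ (n - 1) + c * (y : ℂ) ^ n) * cexp (c * y)‖ := by
            simp only [norm_mul, Complex.norm_real, Real.norm_eq_abs]
        _ ≤ D * (R ^ 2 * Real.exp (R / 2)) + 1 * ((2 * R + R ^ 2) * Real.exp (R / 2)) :=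
            add_le_add (mul_le_mul (hD R y) (hpb y hy.le) (norm_nonneg _) hD0)
              (mul_le_mul (abs_cutoff_le_one R y) (hp'b y hy.le) (norm_nonneg _) zero_le_one)
        _ = (D * R ^ 2 + (2 * R + R ^ 2)) * Real.exp (R / 2) := by ring
  · -- on the window the cutoff is `1`
    intro y hy
    have h1 : cutoff R y = 1 :=
      cutoff_eq_one (by rw [hR, add_sub_cancel_right]; exact abs_le.2 ⟨hy.1, hy.2⟩)
    show ((cutoff R y : ℝ) : ℂ) * ((y : ℂ) ^ n * cexp (c * y)) = _
    rw [h1, hc, Complex.ofReal_one, one_mul]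

/-! ## The stub -/

/-- **Stub `stub_weightedLineBudget`** (W10b, RH-free; takes W9 as hypothesis).  If the
log-weighted critical-line Plancherel integral is form-bounded on every window, then so are the
log-weighted budgets of `(g·yⁿ)^` on the lines `Re s = x ∈ [0, 1]`, `n ≤ 2`:
`∫ ‖(g·yⁿ)^(x+it)‖² log(|t|+2) dt ≤ A·Re Q(g) + B·‖g‖₂²` for test functions `g` supported in
`[-a, a]`, with `A, B ≥ 0` depending only on `a` (shift to the critical line, W9 for
`h = w·g`, `w = cutoff(a+1)·yⁿe^{(x-1/2)y}`, the Markov decomposition of `Re Q` and the multiplier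
bound `stub_dirichletEnergy_mul`). [folklore] -/
theorem stub_weightedLineBudget :
    (∀ a : ℝ, 0 < a → ∃ A B : ℝ, 0 ≤ A ∧ 0 ≤ B ∧ ∀ g : ℝ → ℂ, IsWeilTest g →
      tsupport g ⊆ Icc (-a) a →
        Integrable (fun t : ℝ => ‖weilMellin g (1 / 2 + t * I)‖ ^ 2 * Real.log (|t| + 2)) ∧
        ∫ t : ℝ, ‖weilMellin g (1 / 2 + t * I)‖ ^ 2 * Real.log (|t| + 2) ≤
          A * (weilQuadratic g).re + B * ∫ t : ℝ, ‖g t‖ ^ 2) →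
    ∀ a : ℝ, 0 < a → ∃ A B : ℝ, 0 ≤ A ∧ 0 ≤ B ∧ ∀ g : ℝ → ℂ, IsWeilTest g →
      tsupport g ⊆ Icc (-a) a → ∀ n : ℕ, n ≤ 2 → ∀ x : ℝ, x ∈ Icc (0 : ℝ) 1 →
        Integrable (fun t : ℝ =>
          ‖weilMellin (fun y : ℝ => g y * (y : ℂ) ^ n) (x + t * I)‖ ^ 2 * Real.log (|t| + 2)) ∧
        ∫ t : ℝ, ‖weilMellin (fun y : ℝ => g y * (y : ℂ) ^ n) (x + t * I)‖ ^ 2 *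
            Real.log (|t| + 2) ≤
          A * (weilQuadratic g).re + B * ∫ t : ℝ, ‖g t‖ ^ 2 := by
  intro H9 a ha
  obtain ⟨A₉, B₉, hA₉, hB₉, H⟩ := H9 a ha
  obtain ⟨K, hK0, hK⟩ := stub_dirichletEnergy_mul a ha
  obtain ⟨C, hC0, hC⟩ := lineBudget_exists_abs_weilPoleForm_le a
  obtain ⟨W, L, hW0, hL0, hWL⟩ := lineBudget_exists_multiplier ha
  obtain ⟨B', hB'⟩ : ∃ B' : ℝ,
      B' = 3 * W ^ 2 * (C + |weilMarkovConstant a|) + K * (W ^ 2 + L ^ 2) := ⟨_, rfl⟩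
  have hB'0 : 0 ≤ B' := by rw [hB']; positivity
  refine ⟨2 * A₉ * W ^ 2, A₉ * B' + B₉ * W ^ 2, by positivity, by positivity, ?_⟩
  intro g hg hsupp n hn x hx
  obtain ⟨w, hw, hWb, hLb, hwin⟩ := hWL n hn x hx
  -- the shifted test function `h = w·g = g·yⁿe^{(x-1/2)y}`
  have hwg : IsWeilTest (fun y => w y * g y) := ⟨hw.1.mul hg.1, hg.2.mul_left⟩
  have hwg_supp : tsupport (fun y => w y * g y) ⊆ Icc (-a) a :=
    tsupport_mul_subset_right.trans hsupp
  have hfun : ∀ y : ℝ, g y * (y : ℂ) ^ n * cexp (((x : ℂ) - 1 / 2) * y) = w y * g y := by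
    intro y
    by_cases hy : y ∈ tsupport g
    · rw [hwin y (hsupp hy)]
      ring
    · rw [image_eq_zero_of_notMem_tsupport hy]
      simp
  have hshift : ∀ t : ℝ, weilMellin (fun y : ℝ => g y * (y : ℂ) ^ n) (x + t * I) =
      weilMellin (fun y => w y * g y) (1 / 2 + t * I) := by
    intro t
    rw [lineBudget_weilMellin_shift]
    congr 1
    funext y
    exact hfun y
  obtain ⟨hInt, hIneq⟩ := H (fun y => w y * g y) hwg hwg_supp
  simp_rw [hshift]
  refine ⟨hInt, hIneq.trans ?_⟩
  -- `‖h‖₂² ≤ W² ‖g‖₂²`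
  have hNg0 : 0 ≤ ∫ t, ‖g t‖ ^ 2 := integral_nonneg fun _ => by positivity
  have hNh0 : 0 ≤ ∫ t, ‖w t * g t‖ ^ 2 := integral_nonneg fun _ => by positivity
  have hg2 : Integrable (fun t : ℝ => ‖g t‖ ^ 2) :=
    (memLp_two_iff_integrable_sq_norm hg.memLp_two.1).1 hg.memLp_two
  have hNhle : ∫ t, ‖w t * g t‖ ^ 2 ≤ W ^ 2 * ∫ t, ‖g t‖ ^ 2 := by
    rw [← integral_const_mul]
    refine integral_mono_of_nonneg (ae_of_all _ fun t => by positivity) (hg2.const_mul _)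
      (ae_of_all _ fun t => ?_)
    show ‖w t * g t‖ ^ 2 ≤ W ^ 2 * ‖g t‖ ^ 2
    rw [norm_mul, mul_pow]
    exact mul_le_mul_of_nonneg_right (pow_le_pow_left₀ (norm_nonneg _) (hWb t) 2) (sq_nonneg _)
  -- `Re Q(h) ≤ 2W² Re Q(g) + B' ‖g‖₂²`
  have hQg := weilQuadratic_re_eq_weilPoleForm_add_weilDirichletEnergy_sub hg hsupp
  have hQh := weilQuadratic_re_eq_weilPoleForm_add_weilDirichletEnergy_sub hwg hwg_supp
  have hE := hK w g W L hw hg hsupp hWb hLb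
  have hPg := (abs_le.1 (hC g hg hsupp)).1
  have hPh := (abs_le.1 (hC _ hwg hwg_supp)).2
  have h1 : W ^ 2 * weilDirichletEnergy a g = W ^ 2 * (weilQuadratic g).re -
      W ^ 2 * weilPoleForm g + W ^ 2 * (weilMarkovConstant a * ∫ t, ‖g t‖ ^ 2) := by
    rw [hQg]; ring
  have h2 : W ^ 2 * (-weilPoleForm g) ≤ W ^ 2 * (C * ∫ t, ‖g t‖ ^ 2) :=
    mul_le_mul_of_nonneg_left (by linarith) (sq_nonneg W)
  have h3 : W ^ 2 * (weilMarkovConstant a * ∫ t, ‖g t‖ ^ 2) ≤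
      W ^ 2 * (|weilMarkovConstant a| * ∫ t, ‖g t‖ ^ 2) :=
    mul_le_mul_of_nonneg_left (mul_le_mul_of_nonneg_right (le_abs_self _) hNg0) (sq_nonneg W)
  have h4 : -weilMarkovConstant a * ∫ t, ‖w t * g t‖ ^ 2 ≤
      |weilMarkovConstant a| * ∫ t, ‖w t * g t‖ ^ 2 :=
    mul_le_mul_of_nonneg_right (neg_le_abs _) hNh0
  have h5 : |weilMarkovConstant a| * ∫ t, ‖w t * g t‖ ^ 2 ≤
      |weilMarkovConstant a| * (W ^ 2 * ∫ t, ‖g t‖ ^ 2) :=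
    mul_le_mul_of_nonneg_left hNhle (abs_nonneg _)
  have h6 : C * ∫ t, ‖w t * g t‖ ^ 2 ≤ C * (W ^ 2 * ∫ t, ‖g t‖ ^ 2) :=
    mul_le_mul_of_nonneg_left hNhle hC0
  have hQ : (weilQuadratic (fun y => w y * g y)).re ≤
      2 * W ^ 2 * (weilQuadratic g).re + B' * ∫ t, ‖g t‖ ^ 2 := by
    rw [hB']
    linarith
  -- collect
  have h7 : A₉ * (weilQuadratic (fun y => w y * g y)).re ≤
      A₉ * (2 * W ^ 2 * (weilQuadratic g).re + B' * ∫ t, ‖g t‖ ^ 2) :=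
    mul_le_mul_of_nonneg_left hQ hA₉
  have h8 : B₉ * ∫ t, ‖w t * g t‖ ^ 2 ≤ B₉ * (W ^ 2 * ∫ t, ‖g t‖ ^ 2) :=
    mul_le_mul_of_nonneg_left hNhle hB₉
  linarith

end Summit.RiemannHypothesis.RiemannHypothesis.Theorems.GroundStatesConvergeToXi

end
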